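import Summits.Ventures.LatticeQCDFlow.Scaling.DominatedStarLogSobolevMixing
import Summits.Ventures.LatticeQCDFlow.Scaling.DoeblinHotRegimeFreeRelaxation

/-!
HONEST FRAMING: exact (Metropolis-corrected) sampling algorithms for lattice gauge theory; figures
of merit are autocorrelation/cost numbers at stated couplings and volumes; no continuum-physics
claim.

# DoeblinLogSobolevMixing — THE `log log` MIXING TIME WITH A DOEBLIN HOT SAMPLER, NO REGIME: FOR A `μ_0`-REVERSIBLE HOT KERNEL WITH
# `M_0(u,·) ≥ a·μ_0`, `α(P) ≥ G_a·α₀` AND `α(PP̃) ≥ a(1−t)w_0·G_a·α₀` (`G_a·3m ≤ pct`, `G_a(p + 6K) ≤ p·a·(1−t)w_0`), HENCE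
# **`t_mix(ε) ≤ ⌈(log log(1/π̃_min) + log(1/(2ε²)))/(a(1−t)w_0·G_a·α₀)⌉`** — THE REALISTIC HOT LEVEL KEEPS THE NUMBER OF LEVELS INSIDE A
# DOUBLE LOGARITHM, THE ACCEPTANCE FLOOR `a` ENTERING TWICE LINEARLY (lean-2 GEN-28, ours)

Venture-side (OURS).  Cell `lqcd-flow` (pub-lqcd), unit `pub-lqcd-lean-2-g28`, 2026-08-28.  Chapter N, file 15: `Scaling/DominatedStarLogSobolevMixing`
(N14, exact hot sampler) for the Doeblin hot level of `Scaling/DoeblinHotRegimeFree` (N6) and `Scaling/DoeblinHotRegimeFreeRelaxation` (N12):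
the hot Poincaré constant is `γ₀ = a` (`doeblin_poincare`), and the Dirichlet form of the scheme is at most `(2 − a(1−t)w_0)‖f‖²`
(`doeblinEntryStar_dirichletForm_le`), which is what N13's `logSobolevConst_sq_ge` needs.

## What is proved

* **`doeblinEntryStar_logSobolevConst_ge`** — `α(P) ≥ G_a·α₀` (`α₀ ≤ α(μ_k, E_k)` for all `k`; cold updates arbitrary).
* **`doeblinEntryStar_logSobolevConst_sq_ge`** — `α(PP̃) ≥ a(1−t)w_0·G_a·α₀` (reversible hot and cold kernels).
* **`doeblinEntryStar_mixingTime_le_logSobolev`** — `0 < α₀`, `0 < π̃_min < 1`, `π̃_min ≤ π̃`, `ε > 0`: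
  **`t_mix(ε) ≤ ⌈(log log(1/π̃_min) + log(1/(2ε²)))/(a(1−t)w_0·G_a·α₀)⌉`**.

Reading (no numerics implied): an independence-type hot level with acceptance floor `a` (importance weights within `1/a`) and
transports of one-sided quality `p` give a cold-start mixing time of order `(K/(p·a²))·L_max·log((K+1)L/ε²)` at hot-only half swaps and
uniform listing (`L` one level's `log(1/μ_min)`), with no condition tying the swap fraction to `p` or `a`.  NOT CLAIMED: removal of
`L_max` (item 1); that the second factor `a` is necessary; anything measured.  Literature grade (cell rule): OWN COMPOSITION on
N6/N12/N13/N14; nothing cited as a fact; no new bib keys.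
-/

noncomputable section

open Finset Function Matrix
open Literature.Probability.MarkovChains

namespace Summit.Ventures.LatticeQCDFlow.Scaling

variable {S : Type*} [Fintype S] [DecidableEq S] {K m : ℕ} {μ : Fin (K + 1) → S → ℝ} {M : Fin (K + 1) → S → S → ℝ}
  {w : Fin (K + 1) → ℝ} {t p a : ℝ}

section EntryStar
variable (κ : Fin m → Fin K) (φ : Fin m → Equiv.Perm S)

/-- **`α(P) ≥ G_a·α₀` WITH A DOEBLIN HOT SAMPLER** (`M_0 ≥ a·μ_0`, `0 < a`; `G_a·3m ≤ pct`, `G_a(p + 6K) ≤ p·a·(1−t)w_0`;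
`α₀ ≤ α(μ_k, E_k)`; cold updates arbitrary transition matrices; `|S| ≥ 2`). [ours] -/
theorem doeblinEntryStar_logSobolevConst_ge [Nontrivial S] (hm : 1 ≤ m) (hμ : ∀ k x, 0 < μ k x) (hμ1 : ∀ k, ∑ u, μ k u = 1)
    (hM : ∀ k, IsRowStochastic (M k)) (ha : 0 < a) (hmin : ∀ u v, a * μ 0 v ≤ M 0 u v) (hw0 : ∀ k, 0 ≤ w k) (hwhot : 0 < w 0)
    (ht0 : 0 < t) (ht1 : t < 1) (hp : 0 < p) (hdom : ∀ (r : Fin m) (u : S), p * μ (κ r).succ (φ r u) ≤ μ 0 u)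
    {c : ℕ} (hc1 : 1 ≤ c) (hc : ∀ k : Fin K, c ≤ (univ.filter (fun r : Fin m => κ r = k)).card)
    {G : ℝ} (hG0 : 0 < G) (hG1 : G * (3 * m) ≤ p * c * t) (hG2 : G * (p + 6 * K) ≤ p * a * (1 - t) * w 0)
    {α₀ : ℝ} (hα : ∀ k, α₀ ≤ logSobolevConst (μ k) (fun _ v : S => μ k v)) :
    G * α₀ ≤ logSobolevConst (tensorFun μ) (fun y z : Fin (K + 1) → S =>
        t * ptGraphSwap μ (fun r : Fin m => (((0 : Fin (K + 1)), (κ r).succ) : Fin (K + 1) × Fin (K + 1))) φ y z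
          + (1 - t) * prodKernel w M y z) :=
  dominatedStar_logSobolevConst_ge κ φ hm hμ hμ1 hM ha (doeblin_poincare (fun u => (hμ 0 u).le) (hμ1 0) hmin) hw0 hwhot ht0 ht1 hp
    hdom hc1 hc hG0 hG1 hG2 hα

/-- **`α(PP̃) ≥ a(1−t)w_0·G_a·α₀` WITH A DOEBLIN HOT SAMPLER** (hot kernel `μ_0`-reversible, cold kernels `μ_k`-reversible). [ours] -/
theorem doeblinEntryStar_logSobolevConst_sq_ge [Nontrivial S] (hm : 1 ≤ m) (hμ : ∀ k x, 0 < μ k x) (hμ1 : ∀ k, ∑ u, μ k u = 1)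
    (hM : ∀ k, IsRowStochastic (M k)) (hMrev : ∀ k, DetailedBalance (μ k) (M k)) (ha : 0 < a)
    (hmin : ∀ u v, a * μ 0 v ≤ M 0 u v) (hw0 : ∀ k, 0 ≤ w k) (hw1 : ∑ k, w k = 1) (hwhot : 0 < w 0) (ht0 : 0 < t)
    (ht1 : t < 1) (hp : 0 < p) (hdom : ∀ (r : Fin m) (u : S), p * μ (κ r).succ (φ r u) ≤ μ 0 u)
    {c : ℕ} (hc1 : 1 ≤ c) (hc : ∀ k : Fin K, c ≤ (univ.filter (fun r : Fin m => κ r = k)).card)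
    {G : ℝ} (hG0 : 0 < G) (hG1 : G * (3 * m) ≤ p * c * t) (hG2 : G * (p + 6 * K) ≤ p * a * (1 - t) * w 0)
    {α₀ : ℝ} (hα : ∀ k, α₀ ≤ logSobolevConst (μ k) (fun _ v : S => μ k v)) :
    a * ((1 - t) * w 0) * (G * α₀) ≤ logSobolevConst (tensorFun μ) (mulReversibilization (tensorFun μ)
        (fun y z : Fin (K + 1) → S =>
          t * ptGraphSwap μ (fun r : Fin m => (((0 : Fin (K + 1)), (κ r).succ) : Fin (K + 1) × Fin (K + 1))) φ y z
            + (1 - t) * prodKernel w M y z)) := by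
  have h1t : 0 < 1 - t := by linarith
  have hh : 0 < a * ((1 - t) * w 0) := mul_pos ha (mul_pos h1t hwhot)
  have hsq := logSobolevConst_sq_ge (P := fun y z : Fin (K + 1) → S =>
      t * ptGraphSwap μ (fun r : Fin m => (((0 : Fin (K + 1)), (κ r).succ) : Fin (K + 1) × Fin (K + 1))) φ y z
        + (1 - t) * prodKernel w M y z) (tensorFun_pos hμ) (sum_tensorFun_eq_one μ hμ1)
    (weightedScheme_isRowStochastic (ptGraphSwap_isRowStochastic hμ) hM hw0 hw1 ht0.le ht1.le)
    (weightedScheme_detailedBalance (ptGraphSwap_detailedBalance hμ) hMrev t) hh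
    (fun f => doeblinEntryStar_dirichletForm_le (ptGraphSwap_isRowStochastic hμ) (ptGraphSwap_detailedBalance hμ) ht0.le ht1.le
      hw0 hw1 hμ hμ1 hM hMrev ha.le hmin f)
  have hα := doeblinEntryStar_logSobolevConst_ge κ φ hm hμ hμ1 hM ha hmin hw0 hwhot ht0 ht1 hp hdom hc1 hc hG0 hG1 hG2 hα
  exact (mul_le_mul_of_nonneg_left hα hh.le).trans hsq

/-- **THE `log log` MIXING TIME WITH A DOEBLIN HOT SAMPLER, NO REGIME:**
`t_mix(ε) ≤ ⌈(log log(1/π̃_min) + log(1/(2ε²)))/(a(1−t)w_0·G_a·α₀)⌉`. [ours] -/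
theorem doeblinEntryStar_mixingTime_le_logSobolev [Nontrivial S] (hm : 1 ≤ m) (hμ : ∀ k x, 0 < μ k x)
    (hμ1 : ∀ k, ∑ u, μ k u = 1) (hM : ∀ k, IsRowStochastic (M k)) (hMrev : ∀ k, DetailedBalance (μ k) (M k)) (ha : 0 < a)
    (hmin : ∀ u v, a * μ 0 v ≤ M 0 u v) (hw0 : ∀ k, 0 ≤ w k) (hw1 : ∑ k, w k = 1) (hwhot : 0 < w 0) (ht0 : 0 < t)
    (ht1 : t < 1) (hp : 0 < p) (hdom : ∀ (r : Fin m) (u : S), p * μ (κ r).succ (φ r u) ≤ μ 0 u)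
    {c : ℕ} (hc1 : 1 ≤ c) (hc : ∀ k : Fin K, c ≤ (univ.filter (fun r : Fin m => κ r = k)).card)
    {G : ℝ} (hG0 : 0 < G) (hG1 : G * (3 * m) ≤ p * c * t) (hG2 : G * (p + 6 * K) ≤ p * a * (1 - t) * w 0)
    {α₀ : ℝ} (hα0 : 0 < α₀) (hα : ∀ k, α₀ ≤ logSobolevConst (μ k) (fun _ v : S => μ k v))
    {πmin : ℝ} (hmin0 : 0 < πmin) (hmin1 : πmin < 1) (hπmin : ∀ x, πmin ≤ tensorFun μ x) {ε : ℝ} (hε : 0 < ε) :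
    mixingTime (fun y z : Fin (K + 1) → S =>
        t * ptGraphSwap μ (fun r : Fin m => (((0 : Fin (K + 1)), (κ r).succ) : Fin (K + 1) × Fin (K + 1))) φ y z
          + (1 - t) * prodKernel w M y z) (tensorFun μ) ε
      ≤ ⌈(Real.log (Real.log (1 / πmin)) + Real.log (1 / (2 * ε ^ 2))) / (a * ((1 - t) * w 0) * (G * α₀))⌉₊ := by
  have h1t : 0 < 1 - t := by linarith
  set αP : ℝ := logSobolevConst (tensorFun μ) (mulReversibilization (tensorFun μ)
    (fun y z : Fin (K + 1) → S =>
      t * ptGraphSwap μ (fun r : Fin m => (((0 : Fin (K + 1)), (κ r).succ) : Fin (K + 1) × Fin (K + 1))) φ y z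
        + (1 - t) * prodKernel w M y z)) with hαP
  have hlow : a * ((1 - t) * w 0) * (G * α₀) ≤ αP :=
    doeblinEntryStar_logSobolevConst_sq_ge κ φ hm hμ hμ1 hM hMrev ha hmin hw0 hw1 hwhot ht0 ht1 hp hdom hc1 hc hG0 hG1 hG2 hα
  have hden : 0 < a * ((1 - t) * w 0) * (G * α₀) := mul_pos (mul_pos ha (mul_pos h1t hwhot)) (mul_pos hG0 hα0)
  have hαpos : 0 < αP := lt_of_lt_of_le hden hlow
  have hP := weightedScheme_isRowStochastic (t := t) (w := w)
    (ptGraphSwap_isRowStochastic (e := fun r : Fin m => (((0 : Fin (K + 1)), (κ r).succ) : Fin (K + 1) × Fin (K + 1)))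
      (φ := φ) hμ) hM hw0 hw1 ht0.le ht1.le
  have hDB := weightedScheme_detailedBalance (w := w)
    (ptGraphSwap_detailedBalance (e := fun r : Fin m => (((0 : Fin (K + 1)), (κ r).succ) : Fin (K + 1) × Fin (K + 1)))
      (φ := φ) hμ) hMrev t
  have hT := Miclo1997_mixingTime_le (tensorFun_pos hμ) (sum_tensorFun_eq_one μ hμ1) hP (hDB.isStationary hP.2) hαpos hmin0
    hmin1 hπmin hε
  set N : ℝ := Real.log (Real.log (1 / πmin)) + Real.log (1 / (2 * ε ^ 2)) with hN
  by_cases hN0 : 0 ≤ N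
  · exact hT.trans (Nat.ceil_mono (div_le_div_of_nonneg_left hN0 hden hlow))
  · push Not at hN0
    have hz : ⌈N / αP⌉₊ = 0 := Nat.ceil_eq_zero.mpr (div_nonpos_iff.mpr (Or.inr ⟨hN0.le, hαpos.le⟩))
    rw [hz] at hT
    exact hT.trans (Nat.zero_le _)

end EntryStar

end Summit.Ventures.LatticeQCDFlow.Scaling

end
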